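import Literature.NumberTheory.PAdicHodge.FontaineDpst
import Literature.NumberTheory.GaloisRepresentations.PstWeilDeligneTateTwist
import HarnessLib

/-!
# Clauses (F2), (F3) and cyclotomic de Rham-ness for THE pinned datum — without `FontaineDatumExists`

Topic `Literature/NumberTheory/PAdicHodge`; theorems only (no definition, no named fact).  Since the
D1 upgrade of the pin (2026-08-17, clause (F9) `periodRing_eq_bdR` of `IsFontaineDatum`, file
`FontaineDpst`), the period ring of THE `p`-adic Hodge datum `fontainePst F ℓ hℓ` IS the accepted
construction `bdRPeriodRingData hℓ` of Fontaine's `B_dR(F)` UNCONDITIONALLY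
(`fontainePst_𝔅_eq_bdRPeriodRingData`), for the datum's own — canonical,
`fontainePst_algebra_eq_padicAlgebra` — `ℚ_ℓ`-structure.  Hence every clause of the specification that
only concerns the PERIOD RING is now a theorem about THE datum, with no appeal to the named fact
`FontaineDatumExists` (which remains needed only for the Weil–Deligne half `IsWeilDeligneOf`):

* `PstWeilDeligneData.cyclotomicWeightNegOne_of_bdR` — clause (F2) `CyclotomicWeightNegOne` (the
  cyclotomic character is de Rham with Hodge–Tate weights in `[-1, -1]`: `D_dR(ℚ_ℓ(1)) = F · t⁻¹`,
  `t⁻¹ ∈ Fil⁻¹ ∖ Fil⁰`; Fontaine 1994, Exp. III §1.5) holds for EVERY datum whose period ring is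
  `bdRPeriodRingData` — the datum-level form of the accepted `isDeRhamWithWeightsIn_bdR_cyclotomicPadicAlgCl`
  (file `BdRCyclotomic`), valid for every `ℚ_ℓ`-algebra structure on `F` (there is only one,
  accepted `LocalField.ringHom_padic_ext`);
* `fontainePst_cyclotomicWeightNegOne`, `fontainePst_isDeRhamFramed_cyclotomic` — (F2) and "the
  cyclotomic character is de Rham" for THE datum;
* `fontainePst_unramifiedWeightsZero` — clause (F3) `UnramifiedWeightsZero` for THE datum (accepted
  `PstWeilDeligneData.unramifiedWeightsZero_of_bdR`, file `BdRUnramified`; Fontaine 1994, Exp. III §5);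
* `fontainePst_isDeRhamFramed_tateTwist` (and `…_of_isLocallyUnramified`, `…_one_tateTwist`) — Tate
  twists `ρ ⊗ χ_ℓ^k` of de Rham (resp. unramified, trivial) representations are de Rham for THE datum
  (accepted `PstWeilDeligneData.IsDeRhamFramed.tateTwist`; Fontaine 1994, Exp. III Prop. 1.5.2);
* the specialisations to the summit's datum `fontainePstAdicCompletion v ℓ hv` at a place `v ∣ ℓ` of a
  number field (`fontainePstAdicCompletion_isDeRhamFramed_cyclotomic`, `…_cyclotomicWeightNegOne`,
  `…_unramifiedWeightsZero`, `…_isDeRhamFramed_tateTwist_of_isDeRhamFramed`,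
  `…_isDeRhamFramed_unramified_tateTwist`, `…_isDeRhamFramed_one_tateTwist`), which make the
  "de Rham above `ℓ`" clauses of rank-one reciprocity for `χ₀‖·‖^k` free of `FontaineDatumExists`.

What is deliberately NOT here: clause (F4) (the cyclotomic character is crystalline), (F8) and
everything about `IsWeilDeligneOf` — these concern the Weil–Deligne half of the datum, still pinned by
specification (definition item D2); (F5)–(F7) (Kisin) likewise involve `IsCrystallineFramed`.

## References
* [FontaineAsterisque223III] J.-M. Fontaine, Astérisque 223 (1994), Exp. II §1.5, Exp. III §1.5, §3, §5.
* [BuzzardGee2014] K. Buzzard, T. Gee, *The conjectural connections …* (2014), §2.2 (sign of the weight).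
* [SerreAbelianLadic1968] J.-P. Serre, *Abelian ℓ-adic representations* (1968), Ch. I §1.2.
-/

noncomputable section

open Field IsDedekindDomain ValuativeRel
open scoped NumberField
open Literature.NumberTheory.GaloisRepresentations

namespace Literature.NumberTheory.PAdicHodge

/-! ### Clause (F2) for every datum on `B_dR(F)` -/

section BdR

variable {F : Type} [Field F] [ValuativeRel F] [TopologicalSpace F] [IsNonarchimedeanLocalField F]
  [CharZero F] {p : ℕ} [Fact p.Prime] [Fact (¬ IsUnit (p : integerC F))]
  [IsAdicComplete (Ideal.span {(p : integerC F)}) (integerC F)] (hp : valuation F p < 1)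

omit [Fact (¬ IsUnit (p : integerC F))] [IsAdicComplete (Ideal.span {(p : integerC F)}) (integerC F)] in
/-- Every `ℚ_p`-algebra structure on `F` is the canonical one, pointwise: `algebraMap ℚ_p F = padicRingHom`
(rigidity of `ℚ_p → F`, accepted `LocalField.ringHom_padic_ext`). [cite: SerreLocalFields1979, Ch. II §5] -/
theorem algebraMap_padic_eq_padicRingHom [Algebra ℚ_[p] F] (c : ℚ_[p]) :
    algebraMap ℚ_[p] F c = LocalField.padicRingHom F p hp c :=
  RingHom.congr_fun (LocalField.ringHom_padic_ext (algebraMap ℚ_[p] F) (LocalField.padicRingHom F p hp)) c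

/-- **`ℚ_p(1)` is `B_dR`-admissible** for every `ℚ_p`-algebra structure on `F`
(`isAdmissible_bdR_cyclotomicRepQp` with `algebraMap_padic_eq_padicRingHom`).
[cite: FontaineAsterisque223III, Exp. III §1.5] -/
theorem isAdmissible_bdR_cyclotomicRepQp_of_algebra [Algebra ℚ_[p] F] :
    (bdRPeriodRingData (F := F) (p := p) hp).IsAdmissible (cyclotomicRepQp F p) := by
  haveI := isDomain_bDeRhamPlus (F := F) (p := p) (surjective_fontaineTheta_integerC hp)
  exact isAdmissible_bdR_cyclotomicRepQp hp (algebraMap_padic_eq_padicRingHom hp)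

/-- **The Hodge–Tate weight of `ℚ_p(1)` for `B_dR(F)` is `-1`**, for every `ℚ_p`-algebra structure on
`F` (`hodgeTateWeights_bdR_cyclotomicRepQp`). [cite: FontaineAsterisque223III, Exp. III §1.5]
[cite: BuzzardGee2014, §2.2] -/
theorem hodgeTateWeights_bdR_cyclotomicRepQp_of_algebra [Algebra ℚ_[p] F] :
    (bdRPeriodRingData (F := F) (p := p) hp).hodgeTateWeights (cyclotomicRepQp F p) = {-1} := by
  haveI := isDomain_bDeRhamPlus (F := F) (p := p) (surjective_fontaineTheta_integerC hp)
  exact hodgeTateWeights_bdR_cyclotomicRepQp hp (algebraMap_padic_eq_padicRingHom hp)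

/-- **The cyclotomic character `Γ_F → GL_1(ℚ̄_p)` is `B_dR`-de Rham with weights in `[-1, -1]`**, for
every `ℚ_p`-algebra structure on `F` (the algebra-generic form of
`isDeRhamWithWeightsIn_bdR_cyclotomicPadicAlgCl`). [cite: FontaineAsterisque223III, Exp. III §1.5]
[cite: BuzzardGee2014, §2.2] -/
theorem isDeRhamWithWeightsIn_bdR_cyclotomicPadicAlgCl_of_algebra [Algebra ℚ_[p] F] :
    FramedRep.IsDeRhamWithWeightsIn (bdRPeriodRingData (F := F) (p := p) hp) (-1) (-1)
      (FramedGaloisRep.cyclotomicPadicAlgCl F p) :=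
  isDeRhamWithWeightsIn_cyclotomicPadicAlgCl _ (isAdmissible_bdR_cyclotomicRepQp_of_algebra hp)
    (hodgeTateWeights_bdR_cyclotomicRepQp_of_algebra hp)

omit [Fact (¬ IsUnit (p : integerC F))] [IsAdicComplete (Ideal.span {(p : integerC F)}) (integerC F)] in
/-- **Clause (F2) `CyclotomicWeightNegOne` holds for every `p`-adic Hodge datum whose period ring is
`B_dR(F)`** (`𝔇.𝔅 = bdRPeriodRingData hp` for the datum's own `ℚ_p`-algebra structure; the instance
arguments are the accepted facts `not_isUnit_natCast_integerC`, `isAdicComplete_integerC_natCast`, any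
proofs of which may be supplied): the cyclotomic character is `𝔇`-de Rham with all Hodge–Tate weights
`-1` (`D_dR(ℚ_p(1)) = F · t⁻¹`, `t⁻¹ ∈ Fil⁻¹ ∖ Fil⁰`). Companion of the accepted
`PstWeilDeligneData.unramifiedWeightsZero_of_bdR` (clause (F3)).
[cite: FontaineAsterisque223III, Exp. III §1.5] [cite: BuzzardGee2014, §2.2] -/
theorem _root_.Literature.NumberTheory.GaloisRepresentations.PstWeilDeligneData.cyclotomicWeightNegOne_of_bdR
    [Fact (¬ IsUnit (p : integerC F))] [IsAdicComplete (Ideal.span {(p : integerC F)}) (integerC F)]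
    (𝔇 : PstWeilDeligneData F p)
    (h𝔅 : 𝔇.𝔅 = (letI := 𝔇.algebra; bdRPeriodRingData (F := F) (p := p) hp)) :
    𝔇.CyclotomicWeightNegOne := by
  letI := 𝔇.algebra
  show (FramedGaloisRep.cyclotomicPadicAlgCl F p).IsDeRhamWithWeightsIn 𝔇.𝔅 (-1) (-1)
  rw [h𝔅]
  exact isDeRhamWithWeightsIn_bdR_cyclotomicPadicAlgCl_of_algebra hp

omit [Fact (¬ IsUnit (p : integerC F))] [IsAdicComplete (Ideal.span {(p : integerC F)}) (integerC F)] in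
/-- **The cyclotomic character is `𝔇`-de Rham for every datum whose period ring is `B_dR(F)`.**
[cite: FontaineAsterisque223III, Exp. III §1.5] -/
theorem _root_.Literature.NumberTheory.GaloisRepresentations.PstWeilDeligneData.isDeRhamFramed_cyclotomic_of_bdR
    [Fact (¬ IsUnit (p : integerC F))] [IsAdicComplete (Ideal.span {(p : integerC F)}) (integerC F)]
    (𝔇 : PstWeilDeligneData F p)
    (h𝔅 : 𝔇.𝔅 = (letI := 𝔇.algebra; bdRPeriodRingData (F := F) (p := p) hp)) :
    𝔇.IsDeRhamFramed (FramedGaloisRep.cyclotomicPadicAlgCl F p) :=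
  (𝔇.cyclotomicWeightNegOne_of_bdR hp h𝔅).isDeRhamFramed

end BdR

/-! ### THE datum over a local field -/

section Local

variable {F : Type} [Field F] [ValuativeRel F] [TopologicalSpace F] [IsNonarchimedeanLocalField F]
  [CharZero F] {ℓ : ℕ} [Fact ℓ.Prime]

/-- **Clause (F2) for THE datum — unconditionally**: the cyclotomic character is de Rham for
`fontainePst F ℓ hℓ` with all Hodge–Tate weights `-1` (`fontainePst_𝔅_eq_bdRPeriodRingData` with
`PstWeilDeligneData.cyclotomicWeightNegOne_of_bdR`; Fontaine 1994, Exp. III §1.5: `D_dR(ℚ_ℓ(1)) = F · t⁻¹`).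
[cite: FontaineAsterisque223III, Exp. III §1.5] [cite: BuzzardGee2014, §2.2] -/
theorem fontainePst_cyclotomicWeightNegOne (hℓ : valuation F ℓ < 1) :
    (fontainePst F ℓ hℓ).CyclotomicWeightNegOne := by
  haveI : Fact (¬ IsUnit ((ℓ : ℕ) : integerC F)) := ⟨not_isUnit_natCast_integerC hℓ⟩
  haveI : IsAdicComplete (Ideal.span {((ℓ : ℕ) : integerC F)}) (integerC F) :=
    isAdicComplete_integerC_natCast hℓ
  exact PstWeilDeligneData.cyclotomicWeightNegOne_of_bdR hℓ _ (fontainePst_𝔅_eq_bdRPeriodRingData hℓ)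

/-- **The cyclotomic character is de Rham for THE datum — unconditionally** (formerly a consequence of
clause (F4) under `FontaineDatumExists`, `IsFontaineDatum.isDeRhamFramed_cyclotomic`).
[cite: FontaineAsterisque223III, Exp. III §1.5] -/
theorem fontainePst_isDeRhamFramed_cyclotomic (hℓ : valuation F ℓ < 1) :
    (fontainePst F ℓ hℓ).IsDeRhamFramed (FramedGaloisRep.cyclotomicPadicAlgCl F ℓ) :=
  (fontainePst_cyclotomicWeightNegOne hℓ).isDeRhamFramed

/-- **Clause (F3) for THE datum — unconditionally**: unramified `ρ : Γ_F →ₜ* GL_n(ℚ̄_ℓ)` are de Rham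
for `fontainePst F ℓ hℓ` with all Hodge–Tate weights `0` (`fontainePst_𝔅_eq_bdRPeriodRingData` with the
accepted `PstWeilDeligneData.unramifiedWeightsZero_of_bdR`; Fontaine 1994, Exp. III §5: unramified ⇒
crystalline with `Fil⁰ D = D`, `Fil¹ D = 0`). [cite: FontaineAsterisque223III, Exp. III §5] -/
theorem fontainePst_unramifiedWeightsZero (hℓ : valuation F ℓ < 1) :
    (fontainePst F ℓ hℓ).UnramifiedWeightsZero := by
  haveI : Fact (¬ IsUnit ((ℓ : ℕ) : integerC F)) := ⟨not_isUnit_natCast_integerC hℓ⟩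
  haveI : IsAdicComplete (Ideal.span {((ℓ : ℕ) : integerC F)}) (integerC F) :=
    isAdicComplete_integerC_natCast hℓ
  intro n ρ hρ
  exact PstWeilDeligneData.unramifiedWeightsZero_of_bdR hℓ _ (fontainePst_𝔅_eq_bdRPeriodRingData hℓ) ρ hρ

/-- **Tate twists of de Rham representations are de Rham for THE datum — unconditionally**: if
`ρ : Γ_F →ₜ* GL_n(ℚ̄_ℓ)` is de Rham for `fontainePst F ℓ hℓ` then so is `ρ ⊗ ε` for every `ε = χ_ℓ^k`
(accepted `PstWeilDeligneData.IsDeRhamFramed.tateTwist` fed with `fontainePst_isDeRhamFramed_cyclotomic`;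
formerly `IsFontaineDatum.isDeRhamFramed_tateTwist` under `FontaineDatumExists`).
[cite: FontaineAsterisque223III, Exp. III Prop. 1.5.2] -/
theorem fontainePst_isDeRhamFramed_tateTwist (hℓ : valuation F ℓ < 1) {n : ℕ}
    {ρ : FramedRep (absoluteGaloisGroup F) (PadicAlgCl ℓ) n} (hρ : (fontainePst F ℓ hℓ).IsDeRhamFramed ρ)
    (k : ℤ) (ε : absoluteGaloisGroup F →ₜ* (PadicAlgCl ℓ)ˣ)
    (hε : ∀ σ, (ε σ : PadicAlgCl ℓ) =
      (algebraMap ℚ_[ℓ] (PadicAlgCl ℓ)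
        ((GaloisRep.cyclotomicCharacter F ℓ σ : ℤ_[ℓ]ˣ) : ℤ_[ℓ])) ^ k) :
    (fontainePst F ℓ hℓ).IsDeRhamFramed (ρ.twist ε) :=
  hρ.tateTwist (fontainePst_isDeRhamFramed_cyclotomic hℓ) k ε hε

/-- **Unramified twisted by a power of the cyclotomic character is de Rham for THE datum —
unconditionally** (the shape `ψ ⊗ χ_ℓ^k`, `ψ` unramified, of the `ℓ`-adic avatar at `v ∣ ℓ` of an
algebraic Hecke character `χ₀‖·‖^{-k}` with `χ₀` unramified at `v`).
[cite: FontaineAsterisque223III, Exp. III Prop. 1.5.2] [cite: SerreAbelianLadic1968, Ch. I §1.2] -/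
theorem fontainePst_isDeRhamFramed_tateTwist_of_isLocallyUnramified (hℓ : valuation F ℓ < 1) {n : ℕ}
    {ρ : FramedRep (absoluteGaloisGroup F) (PadicAlgCl ℓ) n} (hρ : ρ.IsLocallyUnramified) (k : ℤ)
    (ε : absoluteGaloisGroup F →ₜ* (PadicAlgCl ℓ)ˣ)
    (hε : ∀ σ, (ε σ : PadicAlgCl ℓ) =
      (algebraMap ℚ_[ℓ] (PadicAlgCl ℓ)
        ((GaloisRep.cyclotomicCharacter F ℓ σ : ℤ_[ℓ]ˣ) : ℤ_[ℓ])) ^ k) :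
    (fontainePst F ℓ hℓ).IsDeRhamFramed (ρ.twist ε) :=
  PstWeilDeligneData.isDeRhamFramed_tateTwist_of_isLocallyUnramified
    (fontainePst_isDeRhamFramed_cyclotomic hℓ) hρ k ε hε

/-- **Powers of the cyclotomic character are de Rham for THE datum — unconditionally**: `1 ⊗ ε` with
`ε = χ_ℓ^k`, as a rank-`n` scalar representation. [cite: FontaineAsterisque223III, Exp. III Prop. 1.5.2] -/
theorem fontainePst_isDeRhamFramed_one_tateTwist (hℓ : valuation F ℓ < 1) {n : ℕ} (k : ℤ)
    (ε : absoluteGaloisGroup F →ₜ* (PadicAlgCl ℓ)ˣ)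
    (hε : ∀ σ, (ε σ : PadicAlgCl ℓ) =
      (algebraMap ℚ_[ℓ] (PadicAlgCl ℓ)
        ((GaloisRep.cyclotomicCharacter F ℓ σ : ℤ_[ℓ]ˣ) : ℤ_[ℓ])) ^ k) :
    (fontainePst F ℓ hℓ).IsDeRhamFramed
      ((1 : FramedRep (absoluteGaloisGroup F) (PadicAlgCl ℓ) n).twist ε) :=
  PstWeilDeligneData.isDeRhamFramed_one_twist (fontainePst_isDeRhamFramed_cyclotomic hℓ) k ε hε

end Local

/-! ### The datum of the summit: `F = K_v`, `v ∣ ℓ` -/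

section NumberField

variable {K : Type} [Field K] [NumberField K]

/-- **The cyclotomic character of `K_v` is de Rham for the summit's datum at `v ∣ ℓ` —
unconditionally** (`fontainePst_isDeRhamFramed_cyclotomic` for `F = K_v`; the hypothesis of the
rank-one "de Rham above `ℓ`" clauses for `χ₀‖·‖^k`). [cite: FontaineAsterisque223III, Exp. III §1.5] -/
theorem fontainePstAdicCompletion_isDeRhamFramed_cyclotomic
    (v : HeightOneSpectrum (𝓞 K)) (ℓ : ℕ) [Fact ℓ.Prime] (hv : ((ℓ : ℕ) : 𝓞 K) ∈ v.asIdeal) :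
    (fontainePstAdicCompletion v ℓ hv).IsDeRhamFramed
      (FramedGaloisRep.cyclotomicPadicAlgCl (v.adicCompletion K) ℓ) := by
  haveI := LocalField.charZero_adicCompletion v
  exact fontainePst_isDeRhamFramed_cyclotomic _

/-- **Clause (F2) for the summit's datum at `v ∣ ℓ` — unconditionally**: the cyclotomic character of
`K_v` is de Rham with all Hodge–Tate weights `-1` (`fontainePst_cyclotomicWeightNegOne`).
[cite: FontaineAsterisque223III, Exp. III §1.5] [cite: BuzzardGee2014, §2.2] -/
theorem fontainePstAdicCompletion_cyclotomicWeightNegOne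
    (v : HeightOneSpectrum (𝓞 K)) (ℓ : ℕ) [Fact ℓ.Prime] (hv : ((ℓ : ℕ) : 𝓞 K) ∈ v.asIdeal) :
    (fontainePstAdicCompletion v ℓ hv).CyclotomicWeightNegOne := by
  haveI := LocalField.charZero_adicCompletion v
  exact fontainePst_cyclotomicWeightNegOne _

/-- **Clause (F3) for the summit's datum at `v ∣ ℓ` — unconditionally**: unramified representations of
`Γ_{K_v}` are de Rham with all Hodge–Tate weights `0` (`fontainePst_unramifiedWeightsZero`).
[cite: FontaineAsterisque223III, Exp. III §5] -/
theorem fontainePstAdicCompletion_unramifiedWeightsZero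
    (v : HeightOneSpectrum (𝓞 K)) (ℓ : ℕ) [Fact ℓ.Prime] (hv : ((ℓ : ℕ) : 𝓞 K) ∈ v.asIdeal) :
    (fontainePstAdicCompletion v ℓ hv).UnramifiedWeightsZero := by
  haveI := LocalField.charZero_adicCompletion v
  intro n ρ hρ
  exact fontainePst_unramifiedWeightsZero _ ρ hρ

/-- **Tate twists preserve "de Rham above `ℓ`" for the summit's datum — unconditionally**: at a place
`v ∣ ℓ`, if `ρ : Γ_{K_v} →ₜ* GL_n(ℚ̄_ℓ)` is de Rham for `fontainePstAdicCompletion v ℓ hv` then so is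
`ρ ⊗ ε` for every `ε = χ_ℓ^k` (the statement of
`fontainePstAdicCompletion_isDeRhamFramed_tateTwist` of file `PstWeilDeligneTateTwist` without its
hypothesis `FontaineDatumExists`). [cite: FontaineAsterisque223III, Exp. III Prop. 1.5.2] -/
theorem fontainePstAdicCompletion_isDeRhamFramed_tateTwist_of_isDeRhamFramed
    (v : HeightOneSpectrum (𝓞 K)) {ℓ : ℕ} [Fact ℓ.Prime] (hv : ((ℓ : ℕ) : 𝓞 K) ∈ v.asIdeal) {n : ℕ}
    {ρ : FramedRep (absoluteGaloisGroup (v.adicCompletion K)) (PadicAlgCl ℓ) n}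
    (hρ : (fontainePstAdicCompletion v ℓ hv).IsDeRhamFramed ρ) (k : ℤ)
    (ε : absoluteGaloisGroup (v.adicCompletion K) →ₜ* (PadicAlgCl ℓ)ˣ)
    (hε : ∀ σ, (ε σ : PadicAlgCl ℓ) =
      (algebraMap ℚ_[ℓ] (PadicAlgCl ℓ)
        ((GaloisRep.cyclotomicCharacter (v.adicCompletion K) ℓ σ : ℤ_[ℓ]ˣ) : ℤ_[ℓ])) ^ k) :
    (fontainePstAdicCompletion v ℓ hv).IsDeRhamFramed (ρ.twist ε) :=
  hρ.tateTwist (fontainePstAdicCompletion_isDeRhamFramed_cyclotomic v ℓ hv) k ε hε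

/-- **… so at `v ∣ ℓ` an unramified representation twisted by `χ_ℓ^k` is de Rham for the summit's
datum — unconditionally** (the `ℓ`-adic avatar at `v ∣ ℓ` of `χ₀‖·‖^{-k}`, `χ₀` unramified at `v`).
[cite: FontaineAsterisque223III, Exp. III Prop. 1.5.2] [cite: SerreAbelianLadic1968, Ch. I §1.2] -/
theorem fontainePstAdicCompletion_isDeRhamFramed_unramified_tateTwist
    (v : HeightOneSpectrum (𝓞 K)) {ℓ : ℕ} [Fact ℓ.Prime] (hv : ((ℓ : ℕ) : 𝓞 K) ∈ v.asIdeal) {n : ℕ}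
    {ρ : FramedRep (absoluteGaloisGroup (v.adicCompletion K)) (PadicAlgCl ℓ) n}
    (hρ : ρ.IsLocallyUnramified) (k : ℤ)
    (ε : absoluteGaloisGroup (v.adicCompletion K) →ₜ* (PadicAlgCl ℓ)ˣ)
    (hε : ∀ σ, (ε σ : PadicAlgCl ℓ) =
      (algebraMap ℚ_[ℓ] (PadicAlgCl ℓ)
        ((GaloisRep.cyclotomicCharacter (v.adicCompletion K) ℓ σ : ℤ_[ℓ]ˣ) : ℤ_[ℓ])) ^ k) :
    (fontainePstAdicCompletion v ℓ hv).IsDeRhamFramed (ρ.twist ε) :=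
  fontainePstAdicCompletion_isDeRhamFramed_tateTwist_of_isDeRhamFramed v hv
    ((fontainePstAdicCompletion v ℓ hv).isDeRhamFramed_of_isLocallyUnramified hρ) k ε hε

/-- **Powers of the cyclotomic character of `K_v` are de Rham for the summit's datum at `v ∣ ℓ` —
unconditionally** (`1 ⊗ ε`, `ε = χ_ℓ^k`, as a rank-`n` scalar representation; the `ℓ`-adic avatar at
`v ∣ ℓ` of `‖·‖^{-k}`). [cite: FontaineAsterisque223III, Exp. III Prop. 1.5.2] -/
theorem fontainePstAdicCompletion_isDeRhamFramed_one_tateTwist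
    (v : HeightOneSpectrum (𝓞 K)) {ℓ : ℕ} [Fact ℓ.Prime] (hv : ((ℓ : ℕ) : 𝓞 K) ∈ v.asIdeal) {n : ℕ}
    (k : ℤ) (ε : absoluteGaloisGroup (v.adicCompletion K) →ₜ* (PadicAlgCl ℓ)ˣ)
    (hε : ∀ σ, (ε σ : PadicAlgCl ℓ) =
      (algebraMap ℚ_[ℓ] (PadicAlgCl ℓ)
        ((GaloisRep.cyclotomicCharacter (v.adicCompletion K) ℓ σ : ℤ_[ℓ]ˣ) : ℤ_[ℓ])) ^ k) :
    (fontainePstAdicCompletion v ℓ hv).IsDeRhamFramed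
      ((1 : FramedRep (absoluteGaloisGroup (v.adicCompletion K)) (PadicAlgCl ℓ) n).twist ε) :=
  PstWeilDeligneData.isDeRhamFramed_one_twist
    (fontainePstAdicCompletion_isDeRhamFramed_cyclotomic v ℓ hv) k ε hε

end NumberField

end Literature.NumberTheory.PAdicHodge

end
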